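import Summits.NavierStokesRegularity.NavierStokesRegularity.Theorems.EulerZoomLiouvillePowerGaugeEulerLiouvilleBreatherPressure

/-!
# Crux `EulerZoomLiouville.PowerGaugeEulerLiouville` (stmt-NavierStokesRegularity-19832), line `logtime-breathers` (T3, weak residue, PAST form):
# the pressure profile of a weak log-time breather from LARGE-SCALE gauges only — `D`-growth

Width seat `ns-ezl-w4` (g3; weak breather rigidity, past form, file L2).  Twin of `BreatherWeak.profile_pressure_growth_of_gaugeD`
(`…BreatherWeakPressure`) with the `D`-gauge hypothesis only at radii `a ≥ 1` — the form available for a time-translated member: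

* `BreatherWeak.profile_pressure_growth_of_gaugeD_of_large` — `∫_{B_L}|Q|^{3/2} ≤ e^{12|c|}(e^{2|c|})^{2−2ρ}c₀ · L^{2−2ρ}` for `L ≥ 2`.

WHAT THIS IS NOT: not NS regularity, not the crux — a data brick for the PAST form of the weak breather-rigidity member; `--supports` stmt-19832. [folklore]
-/

noncomputable section

set_option linter.dupNamespace false

open MeasureTheory Set Filter Topology Metric Function TopologicalSpace
open scoped ENNReal NNReal RealInnerProductSpace ContDiff

namespace Summit.NavierStokesRegularity.NavierStokesRegularity.Theorems.PowerGaugeEulerLiouville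

open Literature.Analysis Literature.Analysis.FunctionSpaces Literature.Analysis.FluidPDE

namespace BreatherWeak

variable {u : ℝ → EuclideanSpace ℝ (Fin 3) → EuclideanSpace ℝ (Fin 3)} {p : ℝ → EuclideanSpace ℝ (Fin 3) → ℝ}
  {c : ℝ} {V : EuclideanSpace ℝ (Fin 3) → EuclideanSpace ℝ (Fin 3)} {Q : EuclideanSpace ℝ (Fin 3) → ℝ}

/-! ### `D`-growth of the pressure profile at large scales -/

/-- **THE `D`-GAUGE OF A BREATHER PRESSURE IN PROFILE VARIABLES from LARGE-SCALE gauge data only.**  As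
`profile_pressure_growth_of_gaugeD`, but `a^{2ρ} D(a; 0; p) ≤ c₀` is required only for `a ≥ 1` (the proof only uses `a = e^{2|c|}L ≥ 2`). [folklore] -/
theorem profile_pressure_growth_of_gaugeD_of_large {ρ : ℝ} {c₀ : ℝ≥0}
    (hpm : AEStronglyMeasurable (uncurry p)
      (volume.restrict (Iio (0 : ℝ) ×ˢ (univ : Set (EuclideanSpace ℝ (Fin 3))))))
    (hp : ∀ τ : ℝ, τ < 0 → ∀ y, p τ y = Real.exp (c * τ) ^ 2 * Q (Real.exp (-(c * τ)) • y))
    (hD : ∀ a : ℝ, 1 ≤ a →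
      ENNReal.ofReal (a ^ (2 * ρ)) * cknD a (0 : ℝ × EuclideanSpace ℝ (Fin 3)) p ≤ (c₀ : ℝ≥0∞))
    {L : ℝ} (hL : 2 ≤ L) :
    ∫⁻ z in ball (0 : EuclideanSpace ℝ (Fin 3)) L, ‖Q z‖ₑ ^ (3 / 2 : ℝ) ≤
      ENNReal.ofReal (Real.exp (12 * |c|) * Real.exp (2 * |c|) ^ (2 - 2 * ρ)) * (c₀ : ℝ≥0∞) *
        ENNReal.ofReal (L ^ (2 - 2 * ρ)) := by
  -- verbatim `profile_pressure_growth_of_gaugeD` (…BreatherWeakPressure) with `hD a ha0 ↦ hD a ha1`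
  have hL0 : 0 < L := by linarith
  have he1 : 1 ≤ Real.exp (2 * |c|) := Real.one_le_exp (by positivity)
  set a : ℝ := Real.exp (2 * |c|) * L with ha
  have haL : L ≤ a := by rw [ha]; nlinarith
  have ha0 : 0 < a := by linarith
  have ha1 : (1 : ℝ) ≤ a := by nlinarith
  -- ### (1) the gauge (LARGE scales only): `X = ∫∫_{Q_a} |p|^{3/2} ≤ a^{2−2ρ} c₀`
  set X : ℝ≥0∞ := ∫⁻ q in parabolicCylinder a (0 : ℝ × EuclideanSpace ℝ (Fin 3)),
    ‖p q.1 q.2‖ₑ ^ (3 / 2 : ℝ) with hX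
  have hXle : X ≤ ENNReal.ofReal (a ^ (2 - 2 * ρ)) * (c₀ : ℝ≥0∞) := by
    have h1 := hD a ha1
    unfold cknD at h1
    have hB0 : ENNReal.ofReal (a ^ (2 * ρ)) ≠ 0 := by
      rw [ENNReal.ofReal_ne_zero_iff]; exact Real.rpow_pos_of_pos ha0 _
    have hA0 : ENNReal.ofReal a ^ 2 ≠ 0 := pow_ne_zero _ (by rw [ENNReal.ofReal_ne_zero_iff]; exact ha0)
    have hAt : ENNReal.ofReal a ^ 2 ≠ ⊤ := ENNReal.pow_ne_top ENNReal.ofReal_ne_top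
    have key : X = ENNReal.ofReal a ^ 2 * (ENNReal.ofReal (a ^ (2 * ρ)))⁻¹ *
        (ENNReal.ofReal (a ^ (2 * ρ)) * ((ENNReal.ofReal a ^ 2)⁻¹ * X)) := by
      rw [← mul_assoc, mul_assoc (ENNReal.ofReal a ^ 2), ENNReal.inv_mul_cancel hB0 ENNReal.ofReal_ne_top,
        mul_one, ← mul_assoc, ENNReal.mul_inv_cancel hA0 hAt, one_mul]
    calc X = _ := key
      _ ≤ ENNReal.ofReal a ^ 2 * (ENNReal.ofReal (a ^ (2 * ρ)))⁻¹ * (c₀ : ℝ≥0∞) := by gcongr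
      _ = ENNReal.ofReal (a ^ (2 - 2 * ρ)) * (c₀ : ℝ≥0∞) := by
          rw [← ENNReal.ofReal_inv_of_pos (Real.rpow_pos_of_pos ha0 _), ← ENNReal.ofReal_pow ha0.le,
            ← ENNReal.ofReal_mul (by positivity)]
          congr 2
          rw [Real.rpow_sub ha0, show a ^ (2 : ℝ) = a ^ (2 : ℕ) by exact_mod_cast Real.rpow_natCast a 2,
            div_eq_mul_inv]
  -- ### (2) the window `(−2,−1) × B_a ⊆ Q_a(0,0)` and Tonelli for `p`
  have hWsub : Ioo (-2 : ℝ) (-1) ×ˢ ball (0 : EuclideanSpace ℝ (Fin 3)) a ⊆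
      parabolicCylinder a (0 : ℝ × EuclideanSpace ℝ (Fin 3)) := by
    intro q hq
    rw [mem_prod, mem_Ioo, mem_ball] at hq
    rw [mem_parabolicCylinder, Prod.fst_zero, Prod.snd_zero, zero_sub]
    have ha2 : (2 : ℝ) ≤ a ^ 2 := by nlinarith
    exact ⟨⟨by linarith [hq.1.1], by linarith [hq.1.2]⟩, hq.2⟩
  have hsubW : Ioo (-2 : ℝ) (-1) ×ˢ ball (0 : EuclideanSpace ℝ (Fin 3)) a ⊆ Iio (0 : ℝ) ×ˢ univ :=
    prod_mono (fun t ht => by have := ht.2; rw [mem_Iio]; linarith) (subset_univ _)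
  have hpmW : AEMeasurable (fun q : ℝ × EuclideanSpace ℝ (Fin 3) => ‖p q.1 q.2‖ₑ ^ (3 / 2 : ℝ))
      (((volume : Measure ℝ).restrict (Ioo (-2 : ℝ) (-1))).prod
        ((volume : Measure (EuclideanSpace ℝ (Fin 3))).restrict (ball 0 a))) := by
    have h : AEMeasurable (fun q : ℝ × EuclideanSpace ℝ (Fin 3) => ‖uncurry p q‖ₑ ^ (3 / 2 : ℝ))
        (volume.restrict (Ioo (-2 : ℝ) (-1) ×ˢ ball (0 : EuclideanSpace ℝ (Fin 3)) a)) :=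
      ((hpm.mono_measure (Measure.restrict_mono hsubW le_rfl)).aemeasurable).enorm.pow_const (3 / 2 : ℝ)
    rw [Measure.volume_eq_prod, ← Measure.prod_restrict] at h
    exact h
  have hYeq : ∫⁻ q in Ioo (-2 : ℝ) (-1) ×ˢ ball (0 : EuclideanSpace ℝ (Fin 3)) a, ‖p q.1 q.2‖ₑ ^ (3 / 2 : ℝ) =
      ∫⁻ τ in Ioo (-2 : ℝ) (-1), ∫⁻ x in ball (0 : EuclideanSpace ℝ (Fin 3)) a, ‖p τ x‖ₑ ^ (3 / 2 : ℝ) := by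
    rw [Measure.volume_eq_prod, ← Measure.prod_restrict, lintegral_prod _ hpmW]
  have hY : ∫⁻ τ in Ioo (-2 : ℝ) (-1), ∫⁻ x in ball (0 : EuclideanSpace ℝ (Fin 3)) a, ‖p τ x‖ₑ ^ (3 / 2 : ℝ) ≤ X := by
    rw [← hYeq]; exact lintegral_mono_set hWsub
  -- ### (3) the slices: `e^{−12|c|} ∫_{B_L}|Q|^{3/2} ≤ ∫_{B_a}|p(τ)|^{3/2}` for `τ ∈ (−2,−1)`
  set J : ℝ≥0∞ := ∫⁻ z in ball (0 : EuclideanSpace ℝ (Fin 3)) L, ‖Q z‖ₑ ^ (3 / 2 : ℝ) with hJ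
  have hslice : ∀ τ ∈ Ioo (-2 : ℝ) (-1), ENNReal.ofReal (Real.exp (-(12 * |c|))) * J ≤
      ∫⁻ x in ball (0 : EuclideanSpace ℝ (Fin 3)) a, ‖p τ x‖ₑ ^ (3 / 2 : ℝ) := by
    intro τ hτ
    have hτ0 : τ < 0 := by linarith [hτ.2]
    have hcτ : |c * τ| ≤ 2 * |c| := by
      rw [abs_mul]
      have : |τ| ≤ 2 := by rw [abs_le]; constructor <;> linarith [hτ.1, hτ.2]
      nlinarith [abs_nonneg c]
    set E : ℝ := Real.exp (c * τ) with hE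
    set d : ℝ := Real.exp (-(c * τ)) with hd
    have hE0 : 0 < E := Real.exp_pos _
    have hd0 : 0 < d := Real.exp_pos _
    -- pointwise: `‖p τ x‖ₑ^{3/2} = ‖E²‖ₑ^{3/2} ‖Q(d x)‖ₑ^{3/2}`
    have hpt : ∀ x, ‖p τ x‖ₑ ^ (3 / 2 : ℝ) = ‖E ^ 2‖ₑ ^ (3 / 2 : ℝ) * ‖Q (d • x)‖ₑ ^ (3 / 2 : ℝ) := by
      intro x
      rw [hp τ hτ0 x, enorm_mul, ENNReal.mul_rpow_of_nonneg _ _ (by norm_num : (0 : ℝ) ≤ 3 / 2)]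
    have hamp : ENNReal.ofReal (Real.exp (-(6 * |c|))) ≤ ‖E ^ 2‖ₑ ^ (3 / 2 : ℝ) := by
      have h1 : Real.exp (-(4 * |c|)) ≤ E ^ 2 := by
        rw [hE, ← Real.exp_nat_mul, Real.exp_le_exp]
        push_cast
        linarith [neg_abs_le (c * τ), le_abs_self (c * τ)]
      have h2 : ENNReal.ofReal (Real.exp (-(4 * |c|))) ≤ ‖E ^ 2‖ₑ := by
        rw [Real.enorm_eq_ofReal (by positivity)]
        exact ENNReal.ofReal_le_ofReal h1
      calc ENNReal.ofReal (Real.exp (-(6 * |c|))) = ENNReal.ofReal (Real.exp (-(4 * |c|))) ^ (3 / 2 : ℝ) := by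
            rw [ENNReal.ofReal_rpow_of_pos (Real.exp_pos _), ← Real.exp_mul]
            ring_nf
        _ ≤ ‖E ^ 2‖ₑ ^ (3 / 2 : ℝ) := ENNReal.rpow_le_rpow h2 (by norm_num)
    -- the dilation `x ↦ d x`
    have hLa : L ≤ d * a := by
      have h1 : Real.exp (-(2 * |c|)) ≤ d := by
        rw [hd, Real.exp_le_exp]; linarith [le_abs_self (c * τ), neg_abs_le (c * τ), hcτ]
      have h2 : Real.exp (-(2 * |c|)) * a = L := by
        rw [ha, ← mul_assoc, ← Real.exp_add, neg_add_cancel, Real.exp_zero, one_mul]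
      rw [← h2]
      exact mul_le_mul_of_nonneg_right h1 ha0.le
    have hcoef : Real.exp (-(6 * |c|)) ≤ (d ^ 3)⁻¹ := by
      rw [hd, ← Real.exp_nat_mul, ← Real.exp_neg, Real.exp_le_exp]
      push_cast
      linarith [le_abs_self (c * τ), neg_abs_le (c * τ), hcτ]
    have hdil : ENNReal.ofReal (Real.exp (-(6 * |c|))) * J ≤
        ∫⁻ x in ball (0 : EuclideanSpace ℝ (Fin 3)) a, ‖Q (d • x)‖ₑ ^ (3 / 2 : ℝ) := by
      rw [lintegral_ball_comp_smul (fun x => ‖Q x‖ₑ ^ (3 / 2 : ℝ)) hd0 a]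
      exact mul_le_mul' (ENNReal.ofReal_le_ofReal hcoef) (lintegral_mono_set (ball_subset_ball hLa))
    have hsplit : Real.exp (-(12 * |c|)) = Real.exp (-(6 * |c|)) * Real.exp (-(6 * |c|)) := by
      rw [← Real.exp_add]; ring_nf
    calc ENNReal.ofReal (Real.exp (-(12 * |c|))) * J
        = ENNReal.ofReal (Real.exp (-(6 * |c|))) * (ENNReal.ofReal (Real.exp (-(6 * |c|))) * J) := by
          rw [hsplit, ENNReal.ofReal_mul (Real.exp_pos _).le, mul_assoc]
      _ ≤ ‖E ^ 2‖ₑ ^ (3 / 2 : ℝ) * ∫⁻ x in ball (0 : EuclideanSpace ℝ (Fin 3)) a, ‖Q (d • x)‖ₑ ^ (3 / 2 : ℝ) :=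
          mul_le_mul' hamp hdil
      _ = ∫⁻ x in ball (0 : EuclideanSpace ℝ (Fin 3)) a, ‖E ^ 2‖ₑ ^ (3 / 2 : ℝ) * ‖Q (d • x)‖ₑ ^ (3 / 2 : ℝ) := by
          rw [lintegral_const_mul' _ _ (ENNReal.rpow_ne_top_of_nonneg (by norm_num) enorm_ne_top)]
      _ = ∫⁻ x in ball (0 : EuclideanSpace ℝ (Fin 3)) a, ‖p τ x‖ₑ ^ (3 / 2 : ℝ) :=
          lintegral_congr fun x => (hpt x).symm
  -- ### (4) integrate over the window (length `1`) and assemble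
  have hvolW : volume (Ioo (-2 : ℝ) (-1)) = 1 := by
    rw [Real.volume_Ioo, show (-1 : ℝ) - -2 = 1 by ring, ENNReal.ofReal_one]
  have hJle : ENNReal.ofReal (Real.exp (-(12 * |c|))) * J ≤ X :=
    calc ENNReal.ofReal (Real.exp (-(12 * |c|))) * J
        = ∫⁻ _ in Ioo (-2 : ℝ) (-1), ENNReal.ofReal (Real.exp (-(12 * |c|))) * J := by
          rw [setLIntegral_const, hvolW, mul_one]
      _ ≤ ∫⁻ τ in Ioo (-2 : ℝ) (-1), ∫⁻ x in ball (0 : EuclideanSpace ℝ (Fin 3)) a, ‖p τ x‖ₑ ^ (3 / 2 : ℝ) :=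
          setLIntegral_mono_ae' measurableSet_Ioo (Eventually.of_forall fun τ hτ => hslice τ hτ)
      _ ≤ X := hY
  have haρ : a ^ (2 - 2 * ρ) = Real.exp (2 * |c|) ^ (2 - 2 * ρ) * L ^ (2 - 2 * ρ) := by
    rw [ha, Real.mul_rpow (Real.exp_pos _).le hL0.le]
  have hunit : ENNReal.ofReal (Real.exp (12 * |c|)) * ENNReal.ofReal (Real.exp (-(12 * |c|))) = 1 := by
    rw [← ENNReal.ofReal_mul (Real.exp_pos _).le, ← Real.exp_add, add_neg_cancel, Real.exp_zero, ENNReal.ofReal_one]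
  calc J = ENNReal.ofReal (Real.exp (12 * |c|)) * (ENNReal.ofReal (Real.exp (-(12 * |c|))) * J) := by
        rw [← mul_assoc, hunit, one_mul]
    _ ≤ ENNReal.ofReal (Real.exp (12 * |c|)) * X := by gcongr
    _ ≤ ENNReal.ofReal (Real.exp (12 * |c|)) * (ENNReal.ofReal (a ^ (2 - 2 * ρ)) * (c₀ : ℝ≥0∞)) := by gcongr
    _ = ENNReal.ofReal (Real.exp (12 * |c|) * Real.exp (2 * |c|) ^ (2 - 2 * ρ)) * (c₀ : ℝ≥0∞) *
          ENNReal.ofReal (L ^ (2 - 2 * ρ)) := by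
        rw [haρ, ENNReal.ofReal_mul (by positivity), ENNReal.ofReal_mul (by positivity)]
        ring

end BreatherWeak

end Summit.NavierStokesRegularity.NavierStokesRegularity.Theorems.PowerGaugeEulerLiouville

end
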